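import Summits.QuantumFields.BalabanUV.T4Continuum.Support.B13ReadingsAvgTowerFactor

/-!
# B13ReadingsAvgTowerUniform — row NE5, located junction J-avg-reg (GAPS § G-ne5p1-Javg-reg), file 4 of 4: THE FACTORISATION INDUCTION RUN
# TO THE END — letter (ℓ1) of `NE2FromNE3BavgBridge.localRate_regClass_of_bavg_consistent`, k-UNIFORM: `RegularTransporters L M R (2α′ + 8κ)
# (2β′ + 16κ)` for an averaging tower `R` from the finest-level letters (α′, β′) of its STRAIGHT tower `S`, the straight and averaging
# structures below the finest level `Kf`, and the one-step correction letter `κ`, under the smallness `α′ ≤ 1∕16`, `κ ≤ 1∕64`, `2 ≤ L`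

Cell `pub-balaban`, unit `b2b-balaban-t4-ne5-p1` (row NE5 OWNER, gen 39; owner item «g39-b» file 2; see file 3 `B13ReadingsAvgTowerFactor` for
provenance: T4-DAG §8 Q49, substrate (ο10) W-25 = L-E19).  Summits-side NEW WORK under the LEAN PLACEMENT RULE: [folklore] bookkeeping on the
ABSTRACT towers of rows NE2 ∕ B5; ONE `Prop`-valued HYPOTHESIS STRUCTURE `FactorisationData` ([shape], like `RegularBackgroundTower.RegularTransporters`:
it NAMES the displayed data — finest level, finest letters, start sites, the two structures, the correction letter — and asserts nothing), 0 other
`def`, nothing printed asserted, no citation tag.  HONEST FRAMING: rung (B)+1 of the FINITE-VOLUME T⁴ programme — NOT infinite volume, NOT a mass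
gap, NOT the Clay problem, NOT a proof of NE5 (NOT PRINTED; GAPS G-t4-U3-1), NOT a proof of NE2; the INSTANCE of `FactorisationData` for Bałaban's
`towerOf ∘ blockAvg ℰ` (R) and `towerOf ∘ axial` (S) with `κ` from [Balaban1985Averaging] Props 1–2 KIND is the substrate's W-25 = L-E19, not
made here.  HONEST DEPENDENCY (cell, verbatim): continuum YM on T⁴ ⇐ BetaPertH ∧ nine spine estimates (0/9 proved); BetaPertH ⇐ (D1) ∧ (D4) ∧
CAP+tail; G-an2-4 gates asym, D1 and NE2/3/4.

THE INDUCTION (downward from `Kf`; at and above `Kf`, `R = S` with letters (α′, β′) — for `towerOf` the finest field itself and the junk levels `1`):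
* straight size, invariant `a_k ≤ α′ + 8α′²(1∕ℓ_k − 1∕ℓ_Kf)` (`straight_size_invariant`; step `a_k ≤ a_{k+1} + a_{k+1}²∕ℓ_k`, closed by
  `8∕L ≤ 4`) ⟹ `a_k ≤ 2α′` at every level (`straight_size_uniform`, `α′ ≤ 1∕8`);
* straight Lipschitz, invariant `b_k ≤ β′·exp(4α′(1∕ℓ_k − 1∕ℓ_Kf))` (`straight_lip_invariant`; step `b_k ≤ e^{2α′∕ℓ_k} b_{k+1}`, closed by
  `4∕L ≤ 2`) ⟹ `b_k ≤ 2β′` (`straight_lip_uniform`; `e^{1∕2} ≤ 1.75`);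
* distance, constant invariant `ρ_k ≤ 8κ` (`dist_uniform`; step `ρ_k ≤ e^{(2α′+8κ)∕ℓ_k}(κ + 8κ∕L) ≤ (1 + 1∕4 + 1∕16)·5κ ≤ 8κ` for
  `α′ ≤ 1∕16`, `κ ≤ 1∕64`, `L ≥ 2` — the level-(k+1) transporter size `≤ 2α′ + 8κ` it needs comes from the inductive `ρ_{k+1}`);
* END `regularTransporters_of_factorisation : RegularTransporters L M R (2α′ + 8κ) (2β′ + 16κ)` and `regularTransporters_straight :
  RegularTransporters L M S (2α′) (2β′)`.
WITH FILE 2: `B13ReadingsAvgTowerDirect.hbavg_of_corrLines` applied to this `RegularTransporters` instance (`2α′ + 8κ ≤ 1` ✓) and the SAME averaging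
structure discharges (ℓ3) with `γ = κe^{2α′+8κ} + (2α′+8κ)² + (2d+1)(2β′+16κ)`; (ℓ2)(ℓ4) stay displayed (second order).  The numeric thresholds are
one admissible choice, not optimal; the instance-holder may re-run the induction lemmas of file 3 with its own.
0 sorry; axioms ⊆ {propext, Classical.choice, Quot.sound}.
-/

noncomputable section

open scoped BigOperators Matrix Matrix.Norms.L2Operator

namespace Summit.QuantumFields.BalabanUV.T4Continuum.B13ReadingsAvgTowerUniform

open Literature.MathematicalPhysics.QuantumFieldTheory.Balaban1983to89.B5Prop11Plancherel (fine Tor)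
open Literature.MathematicalPhysics.QuantumFieldTheory.Balaban1983to89.B5Block118 (tstep)
open Literature.MathematicalPhysics.QuantumFieldTheory.Balaban1983to89.B5G183RateUnitTower (lev lev_neZero)
open Summit.QuantumFields.BalabanUV.T4Continuum.BalabanAveragedTowerUnit (idx one_le_lev' cast_lev' lev_succ')
open Summit.QuantumFields.BalabanUV.T4Continuum.BlockPairingGeometry (tau)
open Summit.QuantumFields.BalabanUV.T4Continuum.RegularBackgroundTower (RegularTransporters)
open Summit.QuantumFields.BalabanUV.T4Continuum.B13ReadingsLineProducts (lprod)
open Summit.QuantumFields.BalabanUV.T4Continuum.B13ReadingsAvgTowerFactor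

variable {d : ℕ} (L : ℕ) [NeZero L] (M : Fin d → ℕ) [hM : ∀ μ, NeZero (M μ)]
variable {o : Type*} [Fintype o] [DecidableEq o]

/-! ## §1 Arithmetic of the levels -/

omit [NeZero L] in
/-- [folklore] `lev` is monotone for `1 ≤ L` (as reals). -/
theorem cast_lev_mono (hL : 1 ≤ L) {k k' : ℕ} (h : k ≤ k') : ((lev L k : ℕ) : ℝ) ≤ ((lev L k' : ℕ) : ℝ) := by
  rw [cast_lev', cast_lev']
  exact pow_le_pow_right₀ (by exact_mod_cast hL) h

omit [NeZero L] in
/-- [folklore] `1∕lev L (k+1) = (1∕L)·(1∕lev L k)`. -/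
theorem inv_lev_succ (k : ℕ) : (((lev L (k + 1) : ℕ) : ℝ))⁻¹ = (L : ℝ)⁻¹ * (((lev L k : ℕ) : ℝ))⁻¹ := by
  rw [lev_succ', Nat.cast_mul, mul_inv]

/-! ## §2 The hypotheses of the induction, as a structure-free list, and the uniform conclusions -/

section Induction

variable {R S : (k : ℕ) → Fin d → (idx L M k → Matrix o o ℂ)}
variable {st : (k : ℕ) → Fin d → idx L M k → Tor (fine (L * lev L k) M)} {Cf : (k : ℕ) → Fin d → idx L M k → Matrix o o ℂ}
variable {Kf : ℕ} {α' β' κ : ℝ}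

/-- [folklore] [shape] The DISPLAYED data of the factorisation induction (a `Prop`-valued HYPOTHESIS STRUCTURE on OUR abstract towers, like
`RegularBackgroundTower.RegularTransporters`; bookkeeping, no printed statement, nothing asserted): finest level `Kf`; the straight tower `S` agrees with `R` at and above `Kf` and carries there the letters (α′, β′); below `Kf` the
straight structure `S k = Π_t S (k+1)(line)` and the averaging structure `R k = Cf k · Π_t R (k+1)(line)` along lines starting at `st k μ i`,
with the start sites of neighbouring coarse indices `L` fine steps apart, and the correction letter `‖Cf − 1‖ ≤ κ∕(lev L k)²`. -/
structure FactorisationData (L : ℕ) [NeZero L] (M : Fin d → ℕ) (R S : (k : ℕ) → Fin d → (idx L M k → Matrix o o ℂ))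
    (st : (k : ℕ) → Fin d → idx L M k → Tor (fine (L * lev L k) M)) (Cf : (k : ℕ) → Fin d → idx L M k → Matrix o o ℂ)
    (Kf : ℕ) (α' β' κ : ℝ) : Prop where
  /-- at and above the finest level the transporter tower IS its straight tower -/
  fin_eq : ∀ k, Kf ≤ k → ∀ μ (x : idx L M k), R k μ x = S k μ x
  /-- finest size letter `α′` (scaled) -/
  fin_size : ∀ k, Kf ≤ k → ∀ μ (x : idx L M k), ‖((lev L k : ℕ) : ℂ) • (S k μ x - 1)‖ ≤ α'
  /-- finest Lipschitz letter `β′∕lev L k` (scaled) -/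
  fin_lip : ∀ k, Kf ≤ k → ∀ μ ν (x : idx L M k),
    ‖((lev L k : ℕ) : ℂ) • (S k μ (tau (fine (lev L k) M) ν x) - S k μ x)‖ ≤ β' / (lev L k : ℕ)
  /-- the start sites of neighbouring coarse indices are `L` fine steps apart -/
  start_shift : ∀ k μ ν (i : idx L M k), st k μ (tau (fine (lev L k) M) ν i) = st k μ i + tstep (fine (L * lev L k) M) ν L
  /-- the straight structure below the finest level: `S k = Π_{t<L} S (k+1)(line t)` -/
  straight : ∀ k, k < Kf → ∀ μ (i : idx L M k),
    S k μ i = lprod (fun t => S (k + 1) μ (st k μ i + tstep (fine (L * lev L k) M) μ t, i.2)) L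
  /-- the averaging structure below the finest level: `R k = Cf k · Π_{t<L} R (k+1)(line t)` -/
  averaging : ∀ k, k < Kf → ∀ μ (i : idx L M k),
    R k μ i = Cf k μ i * lprod (fun t => R (k + 1) μ (st k μ i + tstep (fine (L * lev L k) M) μ t, i.2)) L
  /-- the one-step correction letter `‖Cf − 1‖ ≤ κ∕(lev L k)²` -/
  corr : ∀ k, k < Kf → ∀ μ (i : idx L M k), ‖Cf k μ i - 1‖ ≤ κ / ((lev L k : ℕ) : ℝ) ^ 2

variable (hD : FactorisationData L M R S st Cf Kf α' β' κ)
include hD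

omit hM in
/-- [folklore] **STRAIGHT SIZE, LEVEL-DEPENDENT INVARIANT** for `k ≤ Kf`: `a_k ≤ α′ + 8α′²(1∕ℓ_k − 1∕ℓ_Kf)` (`α′ ≤ 1∕8`, `2 ≤ L`). -/
theorem straight_size_invariant (hL : 2 ≤ L) (hα0 : 0 ≤ α') (hα : α' ≤ 1 / 8) :
    ∀ m k, k + m = Kf → ∀ μ (x : idx L M k),
      ‖((lev L k : ℕ) : ℂ) • (S k μ x - 1)‖ ≤ α' + 8 * α' ^ 2 * ((((lev L k : ℕ) : ℝ))⁻¹ - (((lev L Kf : ℕ) : ℝ))⁻¹) := by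
  have hL1 : 1 ≤ L := le_trans (by norm_num) hL
  have hLr : (2 : ℝ) ≤ L := by exact_mod_cast hL
  intro m
  induction m with
  | zero =>
    intro k hk μ x
    rw [add_zero] at hk; subst hk
    simpa using hD.fin_size k le_rfl μ x
  | succ m ih =>
    intro k hk μ x
    have hkK : k < Kf := by omega
    have hℓ1 : (1 : ℝ) ≤ (lev L k : ℕ) := by exact_mod_cast one_le_lev' L k
    have hℓ0 : (0 : ℝ) < (lev L k : ℕ) := by linarith
    have hℓK : ((lev L (k + 1) : ℕ) : ℝ) ≤ (lev L Kf : ℕ) := cast_lev_mono L hL1 (by omega)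
    have hℓ0' : (0 : ℝ) < (lev L (k + 1) : ℕ) := by exact_mod_cast one_le_lev' L (k + 1)
    -- the level-(k+1) bound and its crude form `≤ 2α′`
    set aS := α' + 8 * α' ^ 2 * ((((lev L (k + 1) : ℕ) : ℝ))⁻¹ - (((lev L Kf : ℕ) : ℝ))⁻¹) with haS
    have hbr : 0 ≤ (((lev L (k + 1) : ℕ) : ℝ))⁻¹ - (((lev L Kf : ℕ) : ℝ))⁻¹ := sub_nonneg.2 (inv_anti₀ hℓ0' hℓK)
    have hbr1 : (((lev L (k + 1) : ℕ) : ℝ))⁻¹ - (((lev L Kf : ℕ) : ℝ))⁻¹ ≤ 1 := by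
      have : (((lev L (k + 1) : ℕ) : ℝ))⁻¹ ≤ 1 := inv_le_one_of_one_le₀ (by exact_mod_cast one_le_lev' L (k + 1))
      have : 0 ≤ (((lev L Kf : ℕ) : ℝ))⁻¹ := by positivity
      linarith
    have haS0 : 0 ≤ aS := by rw [haS]; positivity
    have haS2 : aS ≤ 2 * α' := by
      rw [haS]; nlinarith
    have haSℓ : aS ≤ (lev L k : ℕ) := by nlinarith
    have hprev : ∀ t < L, ‖((L * lev L k : ℕ) : ℂ) • (S (k + 1) μ (st k μ x + tstep (fine (L * lev L k) M) μ t, x.2) - 1)‖ ≤ aS :=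
      fun t _ => ih (k + 1) (by omega) μ _
    have hstep := straight_size_of_step L M hprev haSℓ (hD.straight k hkK μ x)
    refine hstep.trans ?_
    -- `aS + aS²/ℓ_k ≤ α′ + 8α′²(1/ℓ_k − 1/ℓ_Kf)` using `1/ℓ_{k+1} = 1/(Lℓ_k)`, `aS ≤ 2α′`, `L ≥ 2`
    have hsq : aS ^ 2 / (lev L k : ℕ) ≤ 4 * α' ^ 2 * (((lev L k : ℕ) : ℝ))⁻¹ := by
      rw [div_eq_mul_inv]
      exact mul_le_mul_of_nonneg_right (by nlinarith) (by positivity)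
    have hinv : (((lev L (k + 1) : ℕ) : ℝ))⁻¹ ≤ (1 / 2) * (((lev L k : ℕ) : ℝ))⁻¹ := by
      rw [inv_lev_succ]
      exact mul_le_mul_of_nonneg_right (by rw [one_div]; exact inv_anti₀ (by norm_num) hLr) (by positivity)
    rw [haS] at hsq ⊢
    nlinarith [hsq, hinv, sq_nonneg α', inv_nonneg.2 hℓ0.le]

omit hM in
/-- [folklore] **STRAIGHT SIZE, UNIFORM**: `‖ℓ_k•(S k μ x − 1)‖ ≤ 2α′` at EVERY level (`α′ ≤ 1∕8`, `2 ≤ L`). -/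
theorem straight_size_uniform (hL : 2 ≤ L) (hα0 : 0 ≤ α') (hα : α' ≤ 1 / 8) (k : ℕ) (μ : Fin d) (x : idx L M k) :
    ‖((lev L k : ℕ) : ℂ) • (S k μ x - 1)‖ ≤ 2 * α' := by
  rcases le_or_gt Kf k with hk | hk
  · exact (hD.fin_size k hk μ x).trans (by linarith)
  · have h := straight_size_invariant L M hD hL hα0 hα (Kf - k) k (by omega) μ x
    have hℓ : (((lev L k : ℕ) : ℝ))⁻¹ ≤ 1 := inv_le_one_of_one_le₀ (by exact_mod_cast one_le_lev' L k)
    have hK : 0 ≤ (((lev L Kf : ℕ) : ℝ))⁻¹ := by positivity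
    nlinarith [sq_nonneg α']

omit hM in
/-- [folklore] **STRAIGHT LIPSCHITZ, LEVEL-DEPENDENT INVARIANT** for `k ≤ Kf`: `b_k ≤ β′·exp(4α′(1∕ℓ_k − 1∕ℓ_Kf))`. -/
theorem straight_lip_invariant (hL : 2 ≤ L) (hα0 : 0 ≤ α') (hα : α' ≤ 1 / 8) (hβ0 : 0 ≤ β') :
    ∀ m k, k + m = Kf → ∀ μ ν (x : idx L M k),
      ‖((lev L k : ℕ) : ℂ) • (S k μ (tau (fine (lev L k) M) ν x) - S k μ x)‖
        ≤ β' * Real.exp (4 * α' * ((((lev L k : ℕ) : ℝ))⁻¹ - (((lev L Kf : ℕ) : ℝ))⁻¹)) / (lev L k : ℕ) := by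
  have hL1 : 1 ≤ L := le_trans (by norm_num) hL
  have hLr : (2 : ℝ) ≤ L := by exact_mod_cast hL
  intro m
  induction m with
  | zero =>
    intro k hk μ ν x
    rw [add_zero] at hk; subst hk
    simpa using hD.fin_lip k le_rfl μ ν x
  | succ m ih =>
    intro k hk μ ν x
    have hkK : k < Kf := by omega
    have hℓ1 : (1 : ℝ) ≤ (lev L k : ℕ) := by exact_mod_cast one_le_lev' L k
    have hℓ0 : (0 : ℝ) < (lev L k : ℕ) := by linarith
    have hℓ0' : (0 : ℝ) < (lev L (k + 1) : ℕ) := by exact_mod_cast one_le_lev' L (k + 1)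
    have hℓ'eq : ((lev L (k + 1) : ℕ) : ℝ) = L * (lev L k : ℕ) := by rw [lev_succ', Nat.cast_mul]
    set E := Real.exp (4 * α' * ((((lev L (k + 1) : ℕ) : ℝ))⁻¹ - (((lev L Kf : ℕ) : ℝ))⁻¹)) with hE
    -- plain Lipschitz of the level-(k+1) straight parts from the scaled invariant
    have hplain : ∀ (ν' : Fin d) (y : Tor (fine (L * lev L k) M) × Fin d),
        ‖S (k + 1) μ (tau (fine (L * lev L k) M) ν' y) - S (k + 1) μ y‖
          ≤ β' * E / ((L * lev L k : ℕ) : ℝ) / ((L * lev L k : ℕ) : ℝ) := by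
      intro ν' y
      have h := ih (k + 1) (by omega) μ ν' y
      rw [norm_smul, Complex.norm_natCast] at h
      have hℓ'' : (0 : ℝ) < ((L * lev L k : ℕ) : ℝ) := by exact_mod_cast one_le_lev' L (k + 1)
      rw [le_div_iff₀ hℓ'', mul_comm]
      exact h
    have hsize : ∀ y : Tor (fine (L * lev L k) M) × Fin d, ‖((L * lev L k : ℕ) : ℂ) • (S (k + 1) μ y - 1)‖ ≤ 2 * α' :=
      fun y => straight_size_uniform L M hD hL hα0 hα (k + 1) μ y
    have hS' : S k μ (tau (fine (lev L k) M) ν x) = lprod (fun t => S (k + 1) μ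
        (st k μ x + tstep (fine (L * lev L k) M) ν L + tstep (fine (L * lev L k) M) μ t, x.2)) L := by
      have h := hD.straight k hkK μ (tau (fine (lev L k) M) ν x)
      rw [hD.start_shift] at h
      exact h
    have hstep := straight_lipschitz_of_step L M hsize hplain (hD.straight k hkK μ x) hS'
    refine hstep.trans ?_
    -- `exp(2α′/ℓ_k)·β′·E ≤ β′·exp(4α′(1/ℓ_k − 1/ℓ_Kf))`
    rw [mul_comm (Real.exp _) (β' * E), mul_assoc, hE, ← Real.exp_add]
    refine div_le_div_of_nonneg_right (mul_le_mul_of_nonneg_left (Real.exp_le_exp.2 ?_) hβ0) hℓ0.le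
    rw [inv_lev_succ]
    have hLinv : (L : ℝ)⁻¹ ≤ 1 / 2 := by rw [one_div]; exact inv_anti₀ (by norm_num) hLr
    have hι : 0 ≤ (((lev L k : ℕ) : ℝ))⁻¹ := by positivity
    nlinarith [mul_le_mul_of_nonneg_right hLinv hι, div_le_div_of_nonneg_right (show 2 * α' ≤ 2 * α' from le_rfl) hℓ0.le,
      show 2 * α' / ((lev L k : ℕ) : ℝ) = 2 * α' * (((lev L k : ℕ) : ℝ))⁻¹ from div_eq_mul_inv _ _]

omit hM in
/-- [folklore] **STRAIGHT LIPSCHITZ, UNIFORM**: `‖ℓ_k•(S k μ (x + e_ν) − S k μ x)‖ ≤ 2β′∕ℓ_k` at EVERY level (`α′ ≤ 1∕8`, `2 ≤ L`). -/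
theorem straight_lip_uniform (hL : 2 ≤ L) (hα0 : 0 ≤ α') (hα : α' ≤ 1 / 8) (hβ0 : 0 ≤ β') (k : ℕ) (μ ν : Fin d) (x : idx L M k) :
    ‖((lev L k : ℕ) : ℂ) • (S k μ (tau (fine (lev L k) M) ν x) - S k μ x)‖ ≤ 2 * β' / (lev L k : ℕ) := by
  have hℓ0 : (0 : ℝ) < (lev L k : ℕ) := by exact_mod_cast one_le_lev' L k
  rcases le_or_gt Kf k with hk | hk
  · exact (hD.fin_lip k hk μ ν x).trans (div_le_div_of_nonneg_right (by linarith) hℓ0.le)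
  · have h := straight_lip_invariant L M hD hL hα0 hα hβ0 (Kf - k) k (by omega) μ ν x
    refine h.trans (div_le_div_of_nonneg_right ?_ hℓ0.le)
    have hx0 : 0 ≤ 4 * α' * ((((lev L k : ℕ) : ℝ))⁻¹ - (((lev L Kf : ℕ) : ℝ))⁻¹) := by
      have hL1 : 1 ≤ L := le_trans (by norm_num) hL
      have := cast_lev_mono L hL1 hk.le
      have : (((lev L Kf : ℕ) : ℝ))⁻¹ ≤ (((lev L k : ℕ) : ℝ))⁻¹ := inv_anti₀ hℓ0 this
      nlinarith
    have hx1 : 4 * α' * ((((lev L k : ℕ) : ℝ))⁻¹ - (((lev L Kf : ℕ) : ℝ))⁻¹) ≤ 1 / 2 := by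
      have : (((lev L k : ℕ) : ℝ))⁻¹ ≤ 1 := inv_le_one_of_one_le₀ (by exact_mod_cast one_le_lev' L k)
      have : 0 ≤ (((lev L Kf : ℕ) : ℝ))⁻¹ := by positivity
      nlinarith
    have hexp : Real.exp (4 * α' * ((((lev L k : ℕ) : ℝ))⁻¹ - (((lev L Kf : ℕ) : ℝ))⁻¹))
        ≤ 1 + 4 * α' * ((((lev L k : ℕ) : ℝ))⁻¹ - (((lev L Kf : ℕ) : ℝ))⁻¹) + (4 * α' * ((((lev L k : ℕ) : ℝ))⁻¹ - (((lev L Kf : ℕ) : ℝ))⁻¹)) ^ 2 := by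
      have h' := (le_abs_self _).trans (Real.abs_exp_sub_one_sub_id_le (x := 4 * α' * ((((lev L k : ℕ) : ℝ))⁻¹ - (((lev L Kf : ℕ) : ℝ))⁻¹))
        (by rw [abs_of_nonneg hx0]; exact hx1.trans (by norm_num)))
      linarith
    have hE2 : Real.exp (4 * α' * ((((lev L k : ℕ) : ℝ))⁻¹ - (((lev L Kf : ℕ) : ℝ))⁻¹)) ≤ 2 := hexp.trans (by nlinarith)
    calc β' * Real.exp (4 * α' * ((((lev L k : ℕ) : ℝ))⁻¹ - (((lev L Kf : ℕ) : ℝ))⁻¹)) ≤ β' * 2 := mul_le_mul_of_nonneg_left hE2 hβ0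
      _ = 2 * β' := by ring

omit hM in
/-- [folklore] **DISTANCE TO THE STRAIGHT TOWER, UNIFORM**: `‖R k μ x − S k μ x‖ ≤ 8κ∕ℓ_k²` at EVERY level (`α′ ≤ 1∕16`, `κ ≤ 1∕64`, `2 ≤ L`) —
the geometric recursion `ρ_k ≤ e^{1∕4}(κ + 8κ∕L)`. -/
theorem dist_uniform (hL : 2 ≤ L) (hα0 : 0 ≤ α') (hα : α' ≤ 1 / 16) (hκ0 : 0 ≤ κ) (hκ : κ ≤ 1 / 64) :
    ∀ k μ (x : idx L M k), ‖R k μ x - S k μ x‖ ≤ 8 * κ / ((lev L k : ℕ) : ℝ) ^ 2 := by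
  have hα8 : α' ≤ 1 / 8 := hα.trans (by norm_num)
  have hLr : (2 : ℝ) ≤ L := by exact_mod_cast hL
  -- downward induction from `Kf`; above `Kf` the distance is `0`
  suffices h : ∀ m k, k + m = Kf → ∀ μ (x : idx L M k), ‖R k μ x - S k μ x‖ ≤ 8 * κ / ((lev L k : ℕ) : ℝ) ^ 2 by
    intro k μ x
    rcases le_or_gt Kf k with hk | hk
    · rw [hD.fin_eq k hk, sub_self, norm_zero]; positivity
    · exact h (Kf - k) k (by omega) μ x
  intro m
  induction m with
  | zero => intro k hk μ x; rw [add_zero] at hk; subst hk; rw [hD.fin_eq k le_rfl, sub_self, norm_zero]; positivity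
  | succ m ih =>
    intro k hk μ x
    have hkK : k < Kf := by omega
    have hℓ1 : (1 : ℝ) ≤ (lev L k : ℕ) := by exact_mod_cast one_le_lev' L k
    have hℓ0 : (0 : ℝ) < (lev L k : ℕ) := by linarith
    have hℓ'1 : (1 : ℝ) ≤ ((L * lev L k : ℕ) : ℝ) := by exact_mod_cast one_le_lev' L (k + 1)
    have hℓ'0 : (0 : ℝ) < ((L * lev L k : ℕ) : ℝ) := by linarith
    -- level-(k+1) letters along the line
    have hSsize : ∀ t < L, ‖((L * lev L k : ℕ) : ℂ) • (S (k + 1) μ (st k μ x + tstep (fine (L * lev L k) M) μ t, x.2) - 1)‖ ≤ 2 * α' + 8 * κ :=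
      fun t _ => (straight_size_uniform L M hD hL hα0 hα8 (k + 1) μ _).trans (by linarith)
    have hρ' : ∀ t < L, ‖R (k + 1) μ (st k μ x + tstep (fine (L * lev L k) M) μ t, x.2)
        - S (k + 1) μ (st k μ x + tstep (fine (L * lev L k) M) μ t, x.2)‖ ≤ 8 * κ / ((L * lev L k : ℕ) : ℝ) / ((L * lev L k : ℕ) : ℝ) := by
      intro t _
      have h := ih (k + 1) (by omega) μ (st k μ x + tstep (fine (L * lev L k) M) μ t, x.2)
      rw [div_div, ← sq]; exact h
    have hRsize : ∀ t < L, ‖((L * lev L k : ℕ) : ℂ) • (R (k + 1) μ (st k μ x + tstep (fine (L * lev L k) M) μ t, x.2) - 1)‖ ≤ 2 * α' + 8 * κ := by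
      intro t ht
      have h1 := size_of_straight L M (R := R) (S := S) (k := k + 1) (μ := μ)
        (i := (st k μ x + tstep (fine (L * lev L k) M) μ t, x.2)) (ρ := 8 * κ) (ih (k + 1) (by omega) μ _)
      have h2 := straight_size_uniform L M hD hL hα0 hα8 (k + 1) μ (st k μ x + tstep (fine (L * lev L k) M) μ t, x.2)
      have h3 : 8 * κ / ((lev L (k + 1) : ℕ) : ℝ) ≤ 8 * κ := div_le_self (by positivity) (by exact_mod_cast one_le_lev' L (k + 1))
      exact h1.trans (by linarith)
    have hstep := dist_straight_of_step L M hRsize hSsize hρ' (hD.averaging k hkK μ x) (hD.corr k hkK μ x) (hD.straight k hkK μ x)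
    refine hstep.trans (div_le_div_of_nonneg_right ?_ (by positivity))
    -- `e^{(2α′+8κ)/ℓ_k}(κ + 8κ/L) ≤ 8κ`
    have hx0 : 0 ≤ (2 * α' + 8 * κ) / ((lev L k : ℕ) : ℝ) := by positivity
    have hx1 : (2 * α' + 8 * κ) / ((lev L k : ℕ) : ℝ) ≤ 1 / 4 :=
      (div_le_self (by positivity) hℓ1).trans (by linarith)
    have hexp : Real.exp ((2 * α' + 8 * κ) / ((lev L k : ℕ) : ℝ)) ≤ 1 + 1 / 4 + (1 / 4) ^ 2 := by
      have h' := (le_abs_self _).trans (Real.abs_exp_sub_one_sub_id_le (x := (2 * α' + 8 * κ) / ((lev L k : ℕ) : ℝ))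
        (by rw [abs_of_nonneg hx0]; exact hx1.trans (by norm_num)))
      nlinarith [h']
    have hLinv : κ / (L : ℝ) ≤ κ / 2 := div_le_div_of_nonneg_left hκ0 (by norm_num) hLr
    have h8 : 8 * κ / (L : ℝ) = 8 * (κ / L) := by ring
    rw [h8]
    nlinarith [Real.exp_pos ((2 * α' + 8 * κ) / ((lev L k : ℕ) : ℝ))]

omit hM in
/-- [folklore] **END — k-UNIFORM LEVELWISE REGULARITY OF THE AVERAGING TOWER** (letter (ℓ1) of `NE2FromNE3BavgBridge.localRate_regClass_of_bavg_consistent`):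
`RegularTransporters L M R (2α′ + 8κ) (2β′ + 16κ)` — size from `size_of_straight`, Lipschitz from `lipschitz_of_straight`, with the three uniform
bounds above (`α′ ≤ 1∕16`, `κ ≤ 1∕64`, `2 ≤ L`, `0 ≤ β′`). -/
theorem regularTransporters_of_factorisation (hL : 2 ≤ L) (hα0 : 0 ≤ α') (hα : α' ≤ 1 / 16) (hβ0 : 0 ≤ β') (hκ0 : 0 ≤ κ)
    (hκ : κ ≤ 1 / 64) : RegularTransporters L M R (2 * α' + 8 * κ) (2 * β' + 16 * κ) where
  nonneg := ⟨by positivity, by positivity⟩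
  size k ν i := by
    have hα8 : α' ≤ 1 / 8 := hα.trans (by norm_num)
    have h1 := size_of_straight L M (R := R) (S := S) (k := k) (μ := ν) (i := i) (ρ := 8 * κ)
      (dist_uniform L M hD hL hα0 hα hκ0 hκ k ν i)
    have h2 := straight_size_uniform L M hD hL hα0 hα8 k ν i
    have h3 : 8 * κ / ((lev L k : ℕ) : ℝ) ≤ 8 * κ := div_le_self (by positivity) (by exact_mod_cast one_le_lev' L k)
    linarith
  lipschitz k ν μ i := by
    have hα8 : α' ≤ 1 / 8 := hα.trans (by norm_num)
    have h1 := lipschitz_of_straight L M (R := R) (S := S) (k := k) (μ := ν) (ν := μ) (i := i) (ρ := 8 * κ)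
      (dist_uniform L M hD hL hα0 hα hκ0 hκ k ν i) (dist_uniform L M hD hL hα0 hα hκ0 hκ k ν _)
    have h2 := straight_lip_uniform L M hD hL hα0 hα8 hβ0 k ν μ i
    refine h1.trans ?_
    rw [show (2 * β' + 16 * κ) / ((lev L k : ℕ) : ℝ) = 2 * β' / (lev L k : ℕ) + 2 * (8 * κ) / (lev L k : ℕ) by ring]
    exact add_le_add h2 le_rfl

omit hM in
/-- [folklore] … and the STRAIGHT tower is `RegularTransporters L M S (2α′) (2β′)` (`α′ ≤ 1∕8`). -/
theorem regularTransporters_straight (hL : 2 ≤ L) (hα0 : 0 ≤ α') (hα : α' ≤ 1 / 8) (hβ0 : 0 ≤ β') :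
    RegularTransporters L M S (2 * α') (2 * β') where
  nonneg := ⟨by positivity, by positivity⟩
  size k ν i := straight_size_uniform L M hD hL hα0 hα k ν i
  lipschitz k ν μ i := straight_lip_uniform L M hD hL hα0 hα hβ0 k ν μ i

end Induction

end Summit.QuantumFields.BalabanUV.T4Continuum.B13ReadingsAvgTowerUniform

end
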